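import Summits.Ventures.HodgeRepro2.T5BergmanRuhlModel

/-!
# The norms of the higher `K`-types of the weighted Bergman model — Rühl's `(5-99)`

For the weight-`k` Bergman pairing `⟨f₁, f₂⟩_k = ∫_𝔻 f₁ f̄₂ (1 - |z|²)^{k-2} dA` of
`T5BergmanCoefficient` (`k ≥ 2`) the monomials `zⁿ` are the `K`-types `k, k+2, k+4, …`
(`T5BergmanCoefficientL2.act_rot_monomial`), pairwise orthogonal
(`T5BergmanCoefficientL2.pairing_monomial_eq_zero`).  This file computes their norms:

* the Beta integral for natural exponents, in its radial form
  `∫_0^1 r^{2n+1} (1 - r²)^m dr = n! m! / (2 (n+m+1)!)` (induction on `m`, no substitution);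
* `⟨zⁿ, zⁿ⟩_k = π n! (k-2)! / (n+k-1)!` (polar coordinates, `T5BergmanCoefficient.integral_ball_radial`);
* in Rühl's normalisation `ruhlInner k` (= `(2k_R - 1)/π` times the integral, `k = 2 k_R`):
  `(zⁿ, zⁿ) = 1 / C(n+k-1, n)`, so that `Φ_q := N_q^k w^{q-k_R}` with `(N_q^k)² = C(k_R+q-1, q-k_R)`
  — Rühl (1970) §5-8 `(5-98)/(5-99)` verbatim, under `q - k_R = n`, `k_R + q - 1 = n + k - 1` —
  is ORTHONORMAL: `ruhlInner_basis_self` / `ruhlInner_basis_eq_zero`.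

The last «what the kernel does NOT say» item of the explicit model's record (the normalisation
constants `N_q^k` for `q > k`) is thereby in kernel.

Blind lane: Mathlib + the HodgeRepro2 prefix only; no sorry; axioms ⊆ {propext, Classical.choice,
Quot.sound}.
-/

namespace Summit.Ventures.HodgeRepro2.T5BergmanMonomialNorm

open MeasureTheory Metric T5BergmanCoefficient T5BergmanPairing T5BergmanUnitary T5BergmanRuhlModel
open scoped Real Nat

/-! ### The radial Beta integral -/

/-- **The radial Beta integral for natural exponents**:
`∫_0^1 r^{2n+1} (1 - r²)^m dr = n! m! / (2 (n+m+1)!)` — by induction on `m` from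
`(1 - r²)^{m+1} = (1 - r²)^m - r² (1 - r²)^m`, with the closed form satisfying the same recurrence. -/
theorem integral_pow_mul_one_sub_sq_pow (n m : ℕ) :
    ∫ r in (0 : ℝ)..1, r ^ (2 * n + 1) * (1 - r ^ 2) ^ m =
      ((n ! : ℝ) * m !) / (2 * (n + m + 1)!) := by
  induction m generalizing n with
  | zero =>
    simp only [pow_zero, mul_one, Nat.factorial_zero, Nat.cast_one, add_zero]
    rw [integral_pow]
    have h1 : ((2 * n + 1 : ℕ) : ℝ) + 1 = 2 * ((n : ℝ) + 1) := by push_cast; ring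
    rw [h1, one_pow, zero_pow (by omega), sub_zero, Nat.factorial_succ]
    push_cast
    field_simp
  | succ m ih =>
    have e : ∀ r : ℝ, r ^ (2 * n + 1) * (1 - r ^ 2) ^ (m + 1) =
        r ^ (2 * n + 1) * (1 - r ^ 2) ^ m - r ^ (2 * (n + 1) + 1) * (1 - r ^ 2) ^ m := by
      intro r
      ring
    simp_rw [e]
    rw [intervalIntegral.integral_sub
      ((by fun_prop : Continuous fun r : ℝ => r ^ (2 * n + 1) * (1 - r ^ 2) ^ m).intervalIntegrable 0 1)
      ((by fun_prop : Continuous fun r : ℝ => r ^ (2 * (n + 1) + 1) * (1 - r ^ 2) ^ m).intervalIntegrable 0 1),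
      ih n, ih (n + 1)]
    rw [show n + 1 + m + 1 = (n + m + 1) + 1 by ring, show n + (m + 1) + 1 = (n + m + 1) + 1 by ring,
      Nat.factorial_succ (n + m + 1), Nat.factorial_succ n, Nat.factorial_succ m]
    push_cast
    have h1 : ((n + m + 1)! : ℝ) ≠ 0 := by positivity
    have h2 : ((n : ℝ) + m + 1 + 1) ≠ 0 := by positivity
    field_simp
    ring

/-- The same integral over `Ioo 0 1`, in the form produced by `integral_ball_radial`. -/
theorem integral_Ioo_pow_mul_one_sub_sq_pow (n m : ℕ) :
    ∫ r in Set.Ioo (0 : ℝ) 1, r * ((r ^ 2) ^ n * (1 - r ^ 2) ^ m) =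
      ((n ! : ℝ) * m !) / (2 * (n + m + 1)!) := by
  rw [← integral_Ioc_eq_integral_Ioo, ← intervalIntegral.integral_of_le zero_le_one,
    ← integral_pow_mul_one_sub_sq_pow n m]
  congr 1
  ext r
  ring

/-! ### The norm of the monomial `zⁿ` for every weight -/

/-- **`⟨zⁿ, zⁿ⟩_k = π n! (k-2)! / (n+k-1)!`** for `k ≥ 2` — the squared norm of the `K`-type
`k + 2n` of the weight-`k` model (`= π/(k-1)` at `n = 0`, `pairing_lowest_lowest`). -/
theorem pairing_monomial_self (k : ℕ) (hk : 2 ≤ k) (n : ℕ) :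
    pairing k (fun w => w ^ n) (fun w => w ^ n) =
      ((π * ((n ! : ℝ) * (k - 2)!) / (n + k - 1)! : ℝ) : ℂ) := by
  obtain ⟨m, rfl⟩ := Nat.exists_eq_add_of_le' hk
  unfold pairing
  have e : ∀ z : ℂ, z ^ n * (starRingEnd ℂ) (z ^ n) * (((1 - ‖z‖ ^ 2) ^ (m + 2 - 2) : ℝ) : ℂ) =
      (((fun r : ℝ => (r ^ 2) ^ n * (1 - r ^ 2) ^ m) ‖z‖ : ℝ) : ℂ) := by
    intro z
    rw [Complex.mul_conj, Complex.normSq_eq_norm_sq, norm_pow, show m + 2 - 2 = m by omega]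
    push_cast
    ring
  simp_rw [e]
  rw [integral_ball_radial (fun r : ℝ => (r ^ 2) ^ n * (1 - r ^ 2) ^ m) (by fun_prop)]
  have e2 : ∀ r : ℝ, ((r : ℂ) * (((r ^ 2) ^ n * (1 - r ^ 2) ^ m : ℝ) : ℂ)) =
      (((r * ((r ^ 2) ^ n * (1 - r ^ 2) ^ m) : ℝ)) : ℂ) := by
    intro r
    push_cast
    ring
  simp_rw [e2]
  rw [integral_complex_ofReal, integral_Ioo_pow_mul_one_sub_sq_pow n m,
    show m + 2 - 2 = m by omega, show n + (m + 2) - 1 = n + m + 1 by omega]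
  push_cast
  have h1 : ((n + m + 1)! : ℂ) ≠ 0 := by exact_mod_cast (Nat.factorial_pos _).ne'
  field_simp

/-- `⟨zⁿ, zⁿ⟩_k` as a real number: `π n! (k-2)! / (n+k-1)! > 0`. -/
theorem pairing_monomial_self_pos (k : ℕ) (hk : 2 ≤ k) (n : ℕ) :
    0 < (pairing k (fun w => w ^ n) (fun w => w ^ n)).re := by
  rw [pairing_monomial_self k hk n, Complex.ofReal_re]
  positivity

/-! ### Rühl's normalisation: `(5-98)/(5-99)` -/

/-- **`(zⁿ, zⁿ) = 1 / C(n+k-1, n)`** in Rühl's normalisation `(k-1)/π · ∫`: the `(k-1)/π` cancels the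
`π`, and `(k-1)! n! / (n+k-1)! = C(n+k-1, n)⁻¹`. -/
theorem ruhlInner_monomial_self (k : ℕ) (hk : 2 ≤ k) (n : ℕ) :
    ruhlInner k (fun w => w ^ n) (fun w => w ^ n) = (((n + k - 1).choose n : ℝ)⁻¹ : ℝ) := by
  obtain ⟨m, rfl⟩ := Nat.exists_eq_add_of_le' hk
  unfold ruhlInner
  rw [pairing_monomial_self (m + 2) (by omega) n, show m + 2 - 2 = m by omega,
    show n + (m + 2) - 1 = (m + 1) + n by omega]
  have hc := Nat.add_choose_mul_factorial_mul_factorial (m + 1) n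
  have hc' : ((((m + 1) + n).choose n : ℕ) : ℝ) * ((m + 1)! : ℝ) * (n ! : ℝ) = (((m + 1) + n)! : ℝ) := by
    exact_mod_cast hc
  rw [Nat.factorial_succ m] at hc'
  have hπ : (π : ℝ) ≠ 0 := Real.pi_ne_zero
  have h1 : (((m + 1) + n)! : ℝ) ≠ 0 := by positivity
  have h2 : ((((m + 1) + n).choose n : ℕ) : ℝ) ≠ 0 := by
    exact_mod_cast (Nat.choose_pos (by omega)).ne'
  have h3 : (m ! : ℝ) ≠ 0 := by positivity
  have h4 : (n ! : ℝ) ≠ 0 := by positivity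
  rw [← Complex.ofReal_mul]
  congr 1
  push_cast
  rw [show ((m : ℝ) + 2 - 1) = (m : ℝ) + 1 by ring]
  field_simp
  push_cast at hc'
  linear_combination hc'

/-- **Rühl's basis `(5-98)`**: `Φ_q(w) = N_q^k w^{q-k}` with `(N_q^k)² = C(k+q-1, q-k)` `(5-99)` — in the
tree's variables `n = q - k_R`, `k = 2 k_R` (so `k_R + q - 1 = n + k - 1`): `N = √C(n+k-1, n)`. -/
noncomputable def ruhlBasis (k n : ℕ) : ℂ → ℂ :=
  fun w => ((Real.sqrt ((n + k - 1).choose n) : ℝ) : ℂ) * w ^ n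

/-- **`(5-99)`: Rühl's basis vectors have norm `1`** — `(Φ_q, Φ_q) = (N_q^k)² (zⁿ, zⁿ) = 1`. -/
theorem ruhlInner_basis_self (k : ℕ) (hk : 2 ≤ k) (n : ℕ) :
    ruhlInner k (ruhlBasis k n) (ruhlBasis k n) = 1 := by
  unfold ruhlInner ruhlBasis
  rw [pairing_smul_left, pairing_smul_right, Complex.conj_ofReal]
  have := ruhlInner_monomial_self k hk n
  unfold ruhlInner at this
  have hc : (0 : ℝ) < ((n + k - 1).choose n : ℕ) := by exact_mod_cast Nat.choose_pos (by omega)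
  calc ((((k : ℝ) - 1) / π : ℝ) : ℂ) *
        (((Real.sqrt ((n + k - 1).choose n) : ℝ) : ℂ) *
          (((Real.sqrt ((n + k - 1).choose n) : ℝ) : ℂ) * pairing k (fun w => w ^ n) (fun w => w ^ n)))
      = (((Real.sqrt ((n + k - 1).choose n) : ℝ) : ℂ) * ((Real.sqrt ((n + k - 1).choose n) : ℝ) : ℂ)) *
          (((((k : ℝ) - 1) / π : ℝ) : ℂ) * pairing k (fun w => w ^ n) (fun w => w ^ n)) := by ring
    _ = 1 := by
      rw [this, ← Complex.ofReal_mul, Real.mul_self_sqrt hc.le, ← Complex.ofReal_mul,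
        mul_inv_cancel₀ hc.ne', Complex.ofReal_one]

/-- **Orthogonality of `(5-98)`**: `(Φ_q, Φ_{q'}) = 0` for `q ≠ q'`. -/
theorem ruhlInner_basis_eq_zero (k : ℕ) (hk : 2 ≤ k) {n m : ℕ} (hnm : n ≠ m) :
    ruhlInner k (ruhlBasis k n) (ruhlBasis k m) = 0 := by
  unfold ruhlInner ruhlBasis
  rw [pairing_smul_left, pairing_smul_right]
  have := ruhlInner_monomial_eq_zero k hk hnm
  unfold ruhlInner at this
  have h0 : pairing k (fun w => w ^ m) (fun w => w ^ n) = 0 := by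
    rcases mul_eq_zero.mp this with h | h
    · exfalso
      have hk1 : ((k : ℝ) - 1) ≠ 0 := by
        have : (2 : ℝ) ≤ k := by exact_mod_cast hk
        linarith
      have : ((((k : ℝ) - 1) / π : ℝ) : ℂ) ≠ 0 := by
        exact_mod_cast div_ne_zero hk1 Real.pi_ne_zero
      exact this h
    · exact h
  rw [h0]
  ring

/-- **Orthonormality of `(5-98)/(5-99)`** in one statement: `(Φ_q, Φ_{q'}) = δ_{q q'}`. -/
theorem ruhlInner_basis (k : ℕ) (hk : 2 ≤ k) (n m : ℕ) :
    ruhlInner k (ruhlBasis k n) (ruhlBasis k m) = if n = m then 1 else 0 := by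
  split_ifs with h
  · subst h
    exact ruhlInner_basis_self k hk n
  · exact ruhlInner_basis_eq_zero k hk h

end Summit.Ventures.HodgeRepro2.T5BergmanMonomialNorm
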